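import Literature.MathematicalPhysics.MHD.NewcombResonantAlgebraicCertificates
import Literature.Analysis.ODE.ResonantPowerSupersolution
import HarnessLib

/-!
# Newcomb's inner sub-interval `[0, rₛ]` STABLE from a regular supersolution and the power template
# `η = (rₛ − r)^ν P` at the resonance — every hypothesis polynomial after division by `(rₛ − r)^ν`

Topic `Literature/MathematicalPhysics/MHD` (namespace `ScrewPinch.Profile`, vocabulary of `NewcombResonantSurface.lean`:
`kDotB = F`, `newcombF = f`, `newcombG = g`, `fluidEnergyOn`, `FiniteEnergyOn`).  The WORKED η-TEMPLATE requested by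
the cell (gridfusion RULING 9es (5a)): Miyamoto's Theorem 12 on the inner sub-interval in the tree's supersolution form
(`fluidEnergyOn_inner_nonneg_of_supersolutions`, Hartman XI §3/§6 comparison) with the comparison function at the
RESONANT end taken as `w₂ = η := (rₛ − r)^ν · Pw(r)` (`Literature/Analysis/ODE/ResonantPowerSupersolution.lean`):
given the factorisation `f(r) = (rₛ − r)² φ(r)` of Newcomb's `f` near `rₛ` (double zero, Freidberg (11.115)), the
supersolution inequality `(f η′)′ ≤ g η`, the bound `|(f η′)′| ≤ Q η` and positivity become the BRACKET inequalities
`B ≤ g·Pw`, `|B| ≤ Q·Pw`, `Pw > 0` with `B = etaBracket rₛ ν φ φ′ Pw Pw′ Pw″` — polynomial / rational when the profile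
and `Pw` are, hence decidable by exact-ℚ Sturm engines; `ν` is any real making them true (in practice a rational
strictly between the indicial roots, `ν² + ν < g(rₛ)/φ(rₛ)`, Freidberg (11.107); Suydam's criterion makes them real).
MODELLED: straight circular cylinder, ideal MHD, internal modes; nothing about a device.  0 facts, 0 kit.

References: Freidberg, *Ideal MHD* (2014) §11.5.3 (11.105)–(11.116) [Freidberg2014]; Miyamoto (1979/2005) §9.3c(ii)
Theorem 12 [MiyamotoDewar1979]; Hartman, *ODE* (2002) Ch. XI §3, §6 [Hartman2002].
-/

noncomputable section

open Set
open Literature.Analysis.ODE.ResonantPower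

namespace Literature.MathematicalPhysics.MHD

namespace ScrewPinch

namespace Profile

variable {P : Profile} {m k a b : ℝ}

/-- **THEOREM 12 ON THE INNER SUB-INTERVAL WITH THE POWER TEMPLATE AT THE RESONANCE.**  `C¹` profiles on
`(−b, b)` with `B_θ(0) = 0`, `m ≠ 0`, a resonant surface `0 < rₛ < b` (`F(rₛ) = 0`), `F ≠ 0` on `(0, rₛ)`, a matching
point `0 < r₀ < rₛ`.  DATA: (i) a regular-side `C¹` supersolution `w₁` on `(0, rₛ)` exactly as in
`fluidEnergyOn_inner_nonneg_of_supersolutions`; (ii) at the resonant side the TEMPLATE `η = (rₛ − r)^ν Pw(r)`: a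
factorisation `f = (rₛ − r)²φ` on `(r₀′, rₛ)` for some `r₀′ < r₀` with `φ, Pw` differentiable there (`φ′, Pw′, Pw″`
their derivatives), `Pw > 0` on `[r₀, rₛ)`, the bracket `B = etaBracket rₛ ν φ φ′ Pw Pw′ Pw″` continuous on `[r₀, rₛ)`
with `B ≤ g·Pw` on `(r₀, rₛ)` and `|B| ≤ Q₂·Pw` on `[r₀, rₛ)`, `Pw` of class `C¹` on `(0, rₛ)`; (iii) the matching
inequality `η′(r₀)/η(r₀) ≤ w₁′(r₀)/w₁(r₀)` — by `deriv_eta_div_eta` its left side is the RATIONAL number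
`(−ν Pw(r₀) + (rₛ − r₀)Pw′(r₀))/((rₛ − r₀)Pw(r₀))`.  CONCLUSION: every `ξ ∈ C¹(−b, rₛ)` of finite energy at `rₛ` has
`∫₀^{rₛ}(f ξ′² + g ξ²) ≥ 0`.  MODELLED: straight circular cylinder, ideal MHD; nothing about a device.
[cite: MiyamotoDewar1979, §9.3c(ii) Theorem 12] [cite: Freidberg2014, §11.5.3 eqs. (11.105)–(11.116)]
[cite: Hartman2002, Ch. XI §6] -/
theorem fluidEnergyOn_inner_nonneg_of_supersolution_eta {rₛ r₀ r₀' ν Q₁ Q₂ : ℝ}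
    {w₁ q₁ φ φ' Pw Pw' Pw'' : ℝ → ℝ}
    (hr₀ : 0 < r₀) (hr₀ₛ : r₀ < rₛ) (hrₛb : rₛ < b) (hm : m ≠ 0)
    (hBθ : ContDiffOn ℝ 1 P.Bθ (Ioo (-b) b)) (hBz : ContDiffOn ℝ 1 P.Bz (Ioo (-b) b))
    (hp : ContDiffOn ℝ 1 P.p (Ioo (-b) b)) (hBθ0 : P.Bθ 0 = 0)
    (hFs : P.kDotB m k rₛ = 0) (hF : ∀ r ∈ Ioo 0 rₛ, P.kDotB m k r ≠ 0)
    -- (i) the regular-side supersolution, verbatim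
    (hw₁ : ContDiffOn ℝ 1 w₁ (Ioo 0 rₛ)) (hw₁pos : ∀ r ∈ Ioc 0 r₀, 0 < w₁ r)
    (hq₁c : ContinuousOn q₁ (Ioc 0 r₀)) (hq₁w : ∀ r ∈ Ioc 0 r₀, |q₁ r| ≤ Q₁ * w₁ r)
    (hODE₁ : ∀ r ∈ Ioo 0 r₀, HasDerivAt (fun x => P.newcombF m k x * deriv w₁ x) (q₁ r) r)
    (hsuper₁ : ∀ r ∈ Ioo 0 r₀, q₁ r ≤ P.newcombG m k r * w₁ r)
    -- (ii) the η-template at the resonance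
    (hr₀' : r₀' < r₀)
    (hfact : ∀ r ∈ Ioo r₀' rₛ, P.newcombF m k r = (rₛ - r) ^ 2 * φ r)
    (hφ : ∀ r ∈ Ioo r₀' rₛ, HasDerivAt φ (φ' r) r)
    (hPw : ∀ r ∈ Ioo r₀' rₛ, HasDerivAt Pw (Pw' r) r) (hPw' : ∀ r ∈ Ioo r₀' rₛ, HasDerivAt Pw' (Pw'' r) r)
    (hPwC1 : ContDiffOn ℝ 1 Pw (Ioo 0 rₛ)) (hPwpos : ∀ r ∈ Ico r₀ rₛ, 0 < Pw r)
    (hBc : ContinuousOn (etaBracket rₛ ν φ φ' Pw Pw' Pw'') (Ico r₀ rₛ))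
    (hBsuper : ∀ r ∈ Ioo r₀ rₛ, etaBracket rₛ ν φ φ' Pw Pw' Pw'' r ≤ P.newcombG m k r * Pw r)
    (hBabs : ∀ r ∈ Ico r₀ rₛ, |etaBracket rₛ ν φ φ' Pw Pw' Pw'' r| ≤ Q₂ * Pw r)
    -- (iii) matching at r₀
    (hmatch : (-ν * Pw r₀ + (rₛ - r₀) * Pw' r₀) / ((rₛ - r₀) * Pw r₀) ≤ deriv w₁ r₀ / w₁ r₀) :
    ∀ ξ : ℝ → ℝ, ContDiffOn ℝ 1 ξ (Ioo (-b) rₛ) → P.FiniteEnergyOn m k 0 rₛ ξ →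
      0 ≤ P.fluidEnergyOn m k 0 rₛ ξ := by
  -- the resonant-side data in the tree's format
  set w₂ : ℝ → ℝ := eta rₛ ν Pw with hw₂def
  set q₂ : ℝ → ℝ := fun r => (rₛ - r) ^ ν * etaBracket rₛ ν φ φ' Pw Pw' Pw'' r with hq₂def
  have hw₂ : ContDiffOn ℝ 1 w₂ (Ioo 0 rₛ) := contDiffOn_eta (fun r hr => hr.2) hPwC1
  have hw₂pos : ∀ r ∈ Ico r₀ rₛ, 0 < w₂ r := fun r hr => eta_pos hr.2 (hPwpos r hr)
  have hq₂c : ContinuousOn q₂ (Ico r₀ rₛ) := continuousOn_rpow_mul (fun r hr => hr.2) hBc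
  have hq₂w : ∀ r ∈ Ico r₀ rₛ, |q₂ r| ≤ Q₂ * w₂ r := fun r hr => abs_flux_le_of_bracket hr.2 (hBabs r hr)
  have hODE₂ : ∀ r ∈ Ioo r₀ rₛ, HasDerivAt (fun x => P.newcombF m k x * deriv w₂ x) (q₂ r) r := by
    intro r hr
    have hU : Ioo r₀' rₛ ⊆ Iio rₛ := fun y hy => hy.2
    exact hasDerivAt_f_mul_deriv_eta isOpen_Ioo ⟨hr₀'.trans hr.1, hr.2⟩ hU hfact hPw
      (hφ r ⟨hr₀'.trans hr.1, hr.2⟩) (hPw' r ⟨hr₀'.trans hr.1, hr.2⟩)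
  have hsuper₂ : ∀ r ∈ Ioo r₀ rₛ, q₂ r ≤ P.newcombG m k r * w₂ r :=
    fun r hr => super_of_bracket_le hr.2 (hBsuper r hr)
  have hmatch' : deriv w₂ r₀ / w₂ r₀ ≤ deriv w₁ r₀ / w₁ r₀ := by
    have hP0 : Pw r₀ ≠ 0 := (hPwpos r₀ ⟨le_rfl, hr₀ₛ⟩).ne'
    rw [hw₂def, deriv_eta_div_eta hr₀ₛ (hPw r₀ ⟨hr₀', hr₀ₛ⟩) hP0]
    exact hmatch
  exact fluidEnergyOn_inner_nonneg_of_supersolutions hr₀ hr₀ₛ hrₛb hm hBθ hBz hp hBθ0 hFs hF hw₁ hw₁pos hq₁c hq₁w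
    hODE₁ hsuper₁ hw₂ hw₂pos hq₂c hq₂w hODE₂ hsuper₂ hmatch'

/-- **THEOREM 12 ON A MIDDLE SUB-INTERVAL `[r₁, r₂]` WITH THE POWER TEMPLATES AT BOTH RESONANCES.**  As
`fluidEnergyOn_middle_nonneg_of_supersolutions` with `w₁ := etaR r₁ ν₁ P₁` (right of the resonance `r₁`, factorisation
`f = (r − r₁)²φ₁` on `(r₁, r₁′)`, `r₀ < r₁′`) and `w₂ := eta r₂ ν₂ P₂` (left of `r₂`, `f = (r₂ − r)²φ₂` on `(r₂′, r₂)`,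
`r₂′ < r₀`): all certificate hypotheses are the bracket inequalities `etaBracketR … ≤ g·P₁`, `|etaBracketR …| ≤ Q₁P₁`
on the left piece, `etaBracket … ≤ g·P₂`, `|etaBracket …| ≤ Q₂P₂` on the right piece, positivity of `P₁, P₂`, and ONE
rational matching comparison at `r₀`.  MODELLED: straight circular cylinder, ideal MHD; nothing about a device.
[cite: MiyamotoDewar1979, §9.3c(ii) Theorem 12] [cite: Freidberg2014, §11.5.3 eqs. (11.105)–(11.116)]
[cite: Hartman2002, Ch. XI §6] -/
theorem fluidEnergyOn_middle_nonneg_of_supersolution_eta {r₁ r₂ r₀ r₁' r₂' ν₁ ν₂ Q₁ Q₂ : ℝ}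
    {φ₁ φ₁' P₁ P₁' P₁'' φ₂ φ₂' P₂ P₂' P₂'' : ℝ → ℝ}
    (hr₁ : 0 < r₁) (hr₁₀ : r₁ < r₀) (hr₀₂ : r₀ < r₂) (hr₂b : r₂ < b) (hm : m ≠ 0)
    (hBθ : ContDiffOn ℝ 1 P.Bθ (Ioo (-b) b)) (hBz : ContDiffOn ℝ 1 P.Bz (Ioo (-b) b))
    (hp : ContDiffOn ℝ 1 P.p (Ioo (-b) b)) (hF1 : P.kDotB m k r₁ = 0) (hF2 : P.kDotB m k r₂ = 0)
    (hF : ∀ r ∈ Ioo r₁ r₂, P.kDotB m k r ≠ 0)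
    -- template at r₁ (to its right)
    (hr₁' : r₀ < r₁')
    (hfact₁ : ∀ r ∈ Ioo r₁ r₁', P.newcombF m k r = (r - r₁) ^ 2 * φ₁ r)
    (hφ₁ : ∀ r ∈ Ioo r₁ r₁', HasDerivAt φ₁ (φ₁' r) r)
    (hP₁ : ∀ r ∈ Ioo r₁ r₁', HasDerivAt P₁ (P₁' r) r) (hP₁' : ∀ r ∈ Ioo r₁ r₁', HasDerivAt P₁' (P₁'' r) r)
    (hP₁C1 : ContDiffOn ℝ 1 P₁ (Ioo r₁ r₂)) (hP₁pos : ∀ r ∈ Ioc r₁ r₀, 0 < P₁ r)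
    (hB₁c : ContinuousOn (etaBracketR r₁ ν₁ φ₁ φ₁' P₁ P₁' P₁'') (Ioc r₁ r₀))
    (hB₁super : ∀ r ∈ Ioo r₁ r₀, etaBracketR r₁ ν₁ φ₁ φ₁' P₁ P₁' P₁'' r ≤ P.newcombG m k r * P₁ r)
    (hB₁abs : ∀ r ∈ Ioc r₁ r₀, |etaBracketR r₁ ν₁ φ₁ φ₁' P₁ P₁' P₁'' r| ≤ Q₁ * P₁ r)
    -- template at r₂ (to its left)
    (hr₂' : r₂' < r₀)
    (hfact₂ : ∀ r ∈ Ioo r₂' r₂, P.newcombF m k r = (r₂ - r) ^ 2 * φ₂ r)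
    (hφ₂ : ∀ r ∈ Ioo r₂' r₂, HasDerivAt φ₂ (φ₂' r) r)
    (hP₂ : ∀ r ∈ Ioo r₂' r₂, HasDerivAt P₂ (P₂' r) r) (hP₂' : ∀ r ∈ Ioo r₂' r₂, HasDerivAt P₂' (P₂'' r) r)
    (hP₂C1 : ContDiffOn ℝ 1 P₂ (Ioo r₁ r₂)) (hP₂pos : ∀ r ∈ Ico r₀ r₂, 0 < P₂ r)
    (hB₂c : ContinuousOn (etaBracket r₂ ν₂ φ₂ φ₂' P₂ P₂' P₂'') (Ico r₀ r₂))
    (hB₂super : ∀ r ∈ Ioo r₀ r₂, etaBracket r₂ ν₂ φ₂ φ₂' P₂ P₂' P₂'' r ≤ P.newcombG m k r * P₂ r)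
    (hB₂abs : ∀ r ∈ Ico r₀ r₂, |etaBracket r₂ ν₂ φ₂ φ₂' P₂ P₂' P₂'' r| ≤ Q₂ * P₂ r)
    -- rational matching at r₀
    (hmatch : (-ν₂ * P₂ r₀ + (r₂ - r₀) * P₂' r₀) / ((r₂ - r₀) * P₂ r₀)
      ≤ (ν₁ * P₁ r₀ + (r₀ - r₁) * P₁' r₀) / ((r₀ - r₁) * P₁ r₀)) :
    ∀ ξ : ℝ → ℝ, ContDiffOn ℝ 1 ξ (Ioo r₁ r₂) → P.FiniteEnergyOn m k r₁ r₂ ξ →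
      0 ≤ P.fluidEnergyOn m k r₁ r₂ ξ := by
  set w₁ : ℝ → ℝ := etaR r₁ ν₁ P₁ with hw₁def
  set q₁ : ℝ → ℝ := fun r => (r - r₁) ^ ν₁ * etaBracketR r₁ ν₁ φ₁ φ₁' P₁ P₁' P₁'' r
  set w₂ : ℝ → ℝ := eta r₂ ν₂ P₂ with hw₂def
  set q₂ : ℝ → ℝ := fun r => (r₂ - r) ^ ν₂ * etaBracket r₂ ν₂ φ₂ φ₂' P₂ P₂' P₂'' r
  have hw₁ : ContDiffOn ℝ 1 w₁ (Ioo r₁ r₂) := contDiffOn_etaR (fun r hr => hr.1) hP₁C1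
  have hw₁pos : ∀ r ∈ Ioc r₁ r₀, 0 < w₁ r := fun r hr => etaR_pos hr.1 (hP₁pos r hr)
  have hq₁c : ContinuousOn q₁ (Ioc r₁ r₀) := continuousOn_rpow_mulR (fun r hr => hr.1) hB₁c
  have hq₁w : ∀ r ∈ Ioc r₁ r₀, |q₁ r| ≤ Q₁ * w₁ r := fun r hr => abs_fluxR_le_of_bracket hr.1 (hB₁abs r hr)
  have hODE₁ : ∀ r ∈ Ioo r₁ r₀, HasDerivAt (fun x => P.newcombF m k x * deriv w₁ x) (q₁ r) r := by
    intro r hr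
    have hrU : r ∈ Ioo r₁ r₁' := ⟨hr.1, hr.2.trans hr₁'⟩
    exact hasDerivAt_f_mul_deriv_etaR isOpen_Ioo hrU (fun y hy => hy.1) hfact₁ hP₁ (hφ₁ r hrU) (hP₁' r hrU)
  have hsuper₁ : ∀ r ∈ Ioo r₁ r₀, q₁ r ≤ P.newcombG m k r * w₁ r :=
    fun r hr => superR_of_bracket_le hr.1 (hB₁super r hr)
  have hw₂ : ContDiffOn ℝ 1 w₂ (Ioo r₁ r₂) := contDiffOn_eta (fun r hr => hr.2) hP₂C1
  have hw₂pos : ∀ r ∈ Ico r₀ r₂, 0 < w₂ r := fun r hr => eta_pos hr.2 (hP₂pos r hr)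
  have hq₂c : ContinuousOn q₂ (Ico r₀ r₂) := continuousOn_rpow_mul (fun r hr => hr.2) hB₂c
  have hq₂w : ∀ r ∈ Ico r₀ r₂, |q₂ r| ≤ Q₂ * w₂ r := fun r hr => abs_flux_le_of_bracket hr.2 (hB₂abs r hr)
  have hODE₂ : ∀ r ∈ Ioo r₀ r₂, HasDerivAt (fun x => P.newcombF m k x * deriv w₂ x) (q₂ r) r := by
    intro r hr
    have hrU : r ∈ Ioo r₂' r₂ := ⟨hr₂'.trans hr.1, hr.2⟩
    exact hasDerivAt_f_mul_deriv_eta isOpen_Ioo hrU (fun y hy => hy.2) hfact₂ hP₂ (hφ₂ r hrU) (hP₂' r hrU)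
  have hsuper₂ : ∀ r ∈ Ioo r₀ r₂, q₂ r ≤ P.newcombG m k r * w₂ r :=
    fun r hr => super_of_bracket_le hr.2 (hB₂super r hr)
  have hmatch' : deriv w₂ r₀ / w₂ r₀ ≤ deriv w₁ r₀ / w₁ r₀ := by
    have hP10 : P₁ r₀ ≠ 0 := (hP₁pos r₀ ⟨hr₁₀, le_rfl⟩).ne'
    have hP20 : P₂ r₀ ≠ 0 := (hP₂pos r₀ ⟨le_rfl, hr₀₂⟩).ne'
    rw [hw₂def, hw₁def, deriv_eta_div_eta hr₀₂ (hP₂ r₀ ⟨hr₂', hr₀₂⟩) hP20,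
      deriv_etaR_div_etaR hr₁₀ (hP₁ r₀ ⟨hr₁₀, hr₁'⟩) hP10]
    exact hmatch
  exact fluidEnergyOn_middle_nonneg_of_supersolutions hr₁ hr₁₀ hr₀₂ hr₂b hm hBθ hBz hp hF1 hF2 hF hw₁ hw₁pos hq₁c
    hq₁w hODE₁ hsuper₁ hw₂ hw₂pos hq₂c hq₂w hODE₂ hsuper₂ hmatch'

/-- **ONE RESONANT SURFACE: INTERNAL STABILITY WITH THE POWER TEMPLATES ON BOTH SIDES OF `rₛ`.**  As
`stable_oneResonance_of_supersolutions` (the regular-side `w₁` on `(0, r₀]` verbatim — e.g. a polynomial multiple of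
`r^{|m|−1}`), with the comparison function left of the resonance `w₂ := eta rₛ ν P₂` and the one on the last piece
`w := etaR rₛ νo Po` (both templates; factorisation `f = (rₛ − r)²φ` on both sides).  CONCLUSION: every admissible
displacement of the whole plasma has reduced energy `≥ 0`, and `> 0` unless it vanishes on `(rₛ, a]`.  MODELLED: straight
circular cylinder, ideal MHD, internal modes of one Fourier mode `(m, k)`; nothing about a device.
[cite: Freidberg2014, §11.5.3 eqs. (11.105)–(11.116)] [cite: MiyamotoDewar1979, §9.3c(ii) Theorems 3, 7 and 12]
[cite: Hartman2002, Ch. XI §6] -/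
theorem stable_oneResonance_of_supersolutions_eta {rₛ r₀ r₂' a' ν νo Q₁ Q₂ Q : ℝ}
    {w₁ q₁ φ φ' P₂ P₂' P₂'' φo φo' Po Po' Po'' : ℝ → ℝ}
    (hr₀ : 0 < r₀) (hr₀ₛ : r₀ < rₛ) (hrₛa : rₛ < a) (hab : a < b) (hm : m ≠ 0)
    (hBθ : ContDiffOn ℝ 1 P.Bθ (Ioo (-b) b)) (hBz : ContDiffOn ℝ 1 P.Bz (Ioo (-b) b))
    (hp : ContDiffOn ℝ 1 P.p (Ioo (-b) b)) (hBθ0 : P.Bθ 0 = 0)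
    (hFs : P.kDotB m k rₛ = 0) (hFin : ∀ r ∈ Ioo 0 rₛ, P.kDotB m k r ≠ 0)
    (hFout : ∀ r ∈ Ioc rₛ a, P.kDotB m k r ≠ 0)
    -- regular side, verbatim
    (hw₁ : ContDiffOn ℝ 1 w₁ (Ioo 0 rₛ)) (hw₁pos : ∀ r ∈ Ioc 0 r₀, 0 < w₁ r)
    (hq₁c : ContinuousOn q₁ (Ioc 0 r₀)) (hq₁w : ∀ r ∈ Ioc 0 r₀, |q₁ r| ≤ Q₁ * w₁ r)
    (hODE₁ : ∀ r ∈ Ioo 0 r₀, HasDerivAt (fun x => P.newcombF m k x * deriv w₁ x) (q₁ r) r)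
    (hsuper₁ : ∀ r ∈ Ioo 0 r₀, q₁ r ≤ P.newcombG m k r * w₁ r)
    -- template left of rₛ
    (hr₂' : r₂' < r₀)
    (hfact₂ : ∀ r ∈ Ioo r₂' rₛ, P.newcombF m k r = (rₛ - r) ^ 2 * φ r)
    (hφ : ∀ r ∈ Ioo r₂' rₛ, HasDerivAt φ (φ' r) r)
    (hP₂ : ∀ r ∈ Ioo r₂' rₛ, HasDerivAt P₂ (P₂' r) r) (hP₂' : ∀ r ∈ Ioo r₂' rₛ, HasDerivAt P₂' (P₂'' r) r)
    (hP₂C1 : ContDiffOn ℝ 1 P₂ (Ioo 0 rₛ)) (hP₂pos : ∀ r ∈ Ico r₀ rₛ, 0 < P₂ r)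
    (hB₂c : ContinuousOn (etaBracket rₛ ν φ φ' P₂ P₂' P₂'') (Ico r₀ rₛ))
    (hB₂super : ∀ r ∈ Ioo r₀ rₛ, etaBracket rₛ ν φ φ' P₂ P₂' P₂'' r ≤ P.newcombG m k r * P₂ r)
    (hB₂abs : ∀ r ∈ Ico r₀ rₛ, |etaBracket rₛ ν φ φ' P₂ P₂' P₂'' r| ≤ Q₂ * P₂ r)
    (hmatch : (-ν * P₂ r₀ + (rₛ - r₀) * P₂' r₀) / ((rₛ - r₀) * P₂ r₀) ≤ deriv w₁ r₀ / w₁ r₀)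
    -- template right of rₛ (last piece)
    (ha' : a < a')
    (hfacto : ∀ r ∈ Ioo rₛ a', P.newcombF m k r = (r - rₛ) ^ 2 * φo r)
    (hφo : ∀ r ∈ Ioo rₛ a', HasDerivAt φo (φo' r) r)
    (hPo : ∀ r ∈ Ioo rₛ a', HasDerivAt Po (Po' r) r) (hPo' : ∀ r ∈ Ioo rₛ a', HasDerivAt Po' (Po'' r) r)
    (hPoC1 : ContDiffOn ℝ 1 Po (Ioo rₛ b)) (hPopos : ∀ r ∈ Ioc rₛ a, 0 < Po r)
    (hBoc : ContinuousOn (etaBracketR rₛ νo φo φo' Po Po' Po'') (Ioc rₛ a))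
    (hBosuper : ∀ r ∈ Ioo rₛ a, etaBracketR rₛ νo φo φo' Po Po' Po'' r ≤ P.newcombG m k r * Po r)
    (hBoabs : ∀ r ∈ Ioc rₛ a, |etaBracketR rₛ νo φo φo' Po Po' Po'' r| ≤ Q * Po r) :
    ∀ ξ : ℝ → ℝ, ContDiffOn ℝ 1 ξ (Ioo (-b) b \ {rₛ}) → ξ a = 0 → P.FiniteEnergyOn m k 0 a ξ →
      0 ≤ P.fluidEnergy m k a ξ ∧ ((∃ r ∈ Ioc rₛ a, ξ r ≠ 0) → 0 < P.fluidEnergy m k a ξ) := by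
  set w₂ : ℝ → ℝ := eta rₛ ν P₂ with hw₂def
  set q₂ : ℝ → ℝ := fun r => (rₛ - r) ^ ν * etaBracket rₛ ν φ φ' P₂ P₂' P₂'' r
  set w : ℝ → ℝ := etaR rₛ νo Po with hwdef
  set q : ℝ → ℝ := fun r => (r - rₛ) ^ νo * etaBracketR rₛ νo φo φo' Po Po' Po'' r
  have hw₂ : ContDiffOn ℝ 1 w₂ (Ioo 0 rₛ) := contDiffOn_eta (fun r hr => hr.2) hP₂C1
  have hw₂pos : ∀ r ∈ Ico r₀ rₛ, 0 < w₂ r := fun r hr => eta_pos hr.2 (hP₂pos r hr)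
  have hq₂c : ContinuousOn q₂ (Ico r₀ rₛ) := continuousOn_rpow_mul (fun r hr => hr.2) hB₂c
  have hq₂w : ∀ r ∈ Ico r₀ rₛ, |q₂ r| ≤ Q₂ * w₂ r := fun r hr => abs_flux_le_of_bracket hr.2 (hB₂abs r hr)
  have hODE₂ : ∀ r ∈ Ioo r₀ rₛ, HasDerivAt (fun x => P.newcombF m k x * deriv w₂ x) (q₂ r) r := by
    intro r hr
    have hrU : r ∈ Ioo r₂' rₛ := ⟨hr₂'.trans hr.1, hr.2⟩
    exact hasDerivAt_f_mul_deriv_eta isOpen_Ioo hrU (fun y hy => hy.2) hfact₂ hP₂ (hφ r hrU) (hP₂' r hrU)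
  have hsuper₂ : ∀ r ∈ Ioo r₀ rₛ, q₂ r ≤ P.newcombG m k r * w₂ r :=
    fun r hr => super_of_bracket_le hr.2 (hB₂super r hr)
  have hmatch' : deriv w₂ r₀ / w₂ r₀ ≤ deriv w₁ r₀ / w₁ r₀ := by
    have hP20 : P₂ r₀ ≠ 0 := (hP₂pos r₀ ⟨le_rfl, hr₀ₛ⟩).ne'
    rw [hw₂def, deriv_eta_div_eta hr₀ₛ (hP₂ r₀ ⟨hr₂', hr₀ₛ⟩) hP20]
    exact hmatch
  have hw : ContDiffOn ℝ 1 w (Ioo rₛ b) := contDiffOn_etaR (fun r hr => hr.1) hPoC1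
  have hwpos : ∀ r ∈ Ioc rₛ a, 0 < w r := fun r hr => etaR_pos hr.1 (hPopos r hr)
  have hqc : ContinuousOn q (Ioc rₛ a) := continuousOn_rpow_mulR (fun r hr => hr.1) hBoc
  have hqw : ∀ r ∈ Ioc rₛ a, |q r| ≤ Q * w r := fun r hr => abs_fluxR_le_of_bracket hr.1 (hBoabs r hr)
  have hODEw : ∀ r ∈ Ioo rₛ a, HasDerivAt (fun x => P.newcombF m k x * deriv w x) (q r) r := by
    intro r hr
    have hrU : r ∈ Ioo rₛ a' := ⟨hr.1, hr.2.trans ha'⟩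
    exact hasDerivAt_f_mul_deriv_etaR isOpen_Ioo hrU (fun y hy => hy.1) hfacto hPo (hφo r hrU) (hPo' r hrU)
  have hsuper : ∀ r ∈ Ioo rₛ a, q r ≤ P.newcombG m k r * w r :=
    fun r hr => superR_of_bracket_le hr.1 (hBosuper r hr)
  exact stable_oneResonance_of_supersolutions hr₀ hr₀ₛ hrₛa hab hm hBθ hBz hp hBθ0 hFs hFin hFout hw₁ hw₁pos hq₁c
    hq₁w hODE₁ hsuper₁ hw₂ hw₂pos hq₂c hq₂w hODE₂ hsuper₂ hmatch' hw hwpos hqc hqw hODEw hsuper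

/-- **ONE RESONANT SURFACE: EXTERNAL-MODE POSITIVITY WITH THE POWER TEMPLATES ON BOTH SIDES OF `rₛ`.**  As
`externalPos_oneResonance_of_supersolutions` (Newcomb's internal test on `[0, rₛ]` plus Freidberg's external criterion
(11.118) over the last sub-interval `(rₛ, a]`), with the comparison functions of `stable_oneResonance_of_supersolutions_eta`
(`w₂ := eta rₛ ν P₂` left of the resonance, `w := etaR rₛ νo Po` on the last piece).  The boundary datum is RATIONAL in the
template data: `w′(a)/w(a) = (νo·Po(a) + (a − rₛ)·Po′(a))/((a − rₛ)·Po(a))` (`deriv_etaR_div_etaR`), so the external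
condition reads `0 < f(a)·(νo·Po(a) + (a − rₛ)·Po′(a))/((a − rₛ)·Po(a)) + (F F†/k₀² + a²F²Λ/m)(a)`.  CONCLUSION: every
admissible displacement with `ξ(a) ≠ 0` has positive external-mode energy for the wall factor `Λ`.  MODELLED: straight
circular cylinder, ideal MHD, one Fourier mode `(m, k)`, vacuum + wall encoded by `Λ`; nothing about a device.
[cite: Freidberg2014, §11.5.3 eqs. (11.105)–(11.118)] [cite: MiyamotoDewar1979, §9.3c(ii) Theorems 3, 7 and 12]
[cite: Hartman2002, Ch. XI §6] -/
theorem externalPos_oneResonance_of_supersolutions_eta {rₛ r₀ r₂' a' ν νo Q₁ Q₂ Q : ℝ}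
    {w₁ q₁ φ φ' P₂ P₂' P₂'' φo φo' Po Po' Po'' : ℝ → ℝ}
    (hr₀ : 0 < r₀) (hr₀ₛ : r₀ < rₛ) (hrₛa : rₛ < a) (hab : a < b) (hm : m ≠ 0)
    (hBθ : ContDiffOn ℝ 1 P.Bθ (Ioo (-b) b)) (hBz : ContDiffOn ℝ 1 P.Bz (Ioo (-b) b))
    (hp : ContDiffOn ℝ 1 P.p (Ioo (-b) b)) (hBθ0 : P.Bθ 0 = 0)
    (hFs : P.kDotB m k rₛ = 0) (hFin : ∀ r ∈ Ioo 0 rₛ, P.kDotB m k r ≠ 0)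
    (hFout : ∀ r ∈ Ioc rₛ a, P.kDotB m k r ≠ 0)
    -- regular side, verbatim
    (hw₁ : ContDiffOn ℝ 1 w₁ (Ioo 0 rₛ)) (hw₁pos : ∀ r ∈ Ioc 0 r₀, 0 < w₁ r)
    (hq₁c : ContinuousOn q₁ (Ioc 0 r₀)) (hq₁w : ∀ r ∈ Ioc 0 r₀, |q₁ r| ≤ Q₁ * w₁ r)
    (hODE₁ : ∀ r ∈ Ioo 0 r₀, HasDerivAt (fun x => P.newcombF m k x * deriv w₁ x) (q₁ r) r)
    (hsuper₁ : ∀ r ∈ Ioo 0 r₀, q₁ r ≤ P.newcombG m k r * w₁ r)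
    -- template left of rₛ
    (hr₂' : r₂' < r₀)
    (hfact₂ : ∀ r ∈ Ioo r₂' rₛ, P.newcombF m k r = (rₛ - r) ^ 2 * φ r)
    (hφ : ∀ r ∈ Ioo r₂' rₛ, HasDerivAt φ (φ' r) r)
    (hP₂ : ∀ r ∈ Ioo r₂' rₛ, HasDerivAt P₂ (P₂' r) r) (hP₂' : ∀ r ∈ Ioo r₂' rₛ, HasDerivAt P₂' (P₂'' r) r)
    (hP₂C1 : ContDiffOn ℝ 1 P₂ (Ioo 0 rₛ)) (hP₂pos : ∀ r ∈ Ico r₀ rₛ, 0 < P₂ r)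
    (hB₂c : ContinuousOn (etaBracket rₛ ν φ φ' P₂ P₂' P₂'') (Ico r₀ rₛ))
    (hB₂super : ∀ r ∈ Ioo r₀ rₛ, etaBracket rₛ ν φ φ' P₂ P₂' P₂'' r ≤ P.newcombG m k r * P₂ r)
    (hB₂abs : ∀ r ∈ Ico r₀ rₛ, |etaBracket rₛ ν φ φ' P₂ P₂' P₂'' r| ≤ Q₂ * P₂ r)
    (hmatch : (-ν * P₂ r₀ + (rₛ - r₀) * P₂' r₀) / ((rₛ - r₀) * P₂ r₀) ≤ deriv w₁ r₀ / w₁ r₀)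
    -- template right of rₛ (last piece)
    (ha' : a < a')
    (hfacto : ∀ r ∈ Ioo rₛ a', P.newcombF m k r = (r - rₛ) ^ 2 * φo r)
    (hφo : ∀ r ∈ Ioo rₛ a', HasDerivAt φo (φo' r) r)
    (hPo : ∀ r ∈ Ioo rₛ a', HasDerivAt Po (Po' r) r) (hPo' : ∀ r ∈ Ioo rₛ a', HasDerivAt Po' (Po'' r) r)
    (hPoC1 : ContDiffOn ℝ 1 Po (Ioo rₛ b)) (hPopos : ∀ r ∈ Ioc rₛ a, 0 < Po r)
    (hBoc : ContinuousOn (etaBracketR rₛ νo φo φo' Po Po' Po'') (Ioc rₛ a))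
    (hBosuper : ∀ r ∈ Ioo rₛ a, etaBracketR rₛ νo φo φo' Po Po' Po'' r ≤ P.newcombG m k r * Po r)
    (hBoabs : ∀ r ∈ Ioc rₛ a, |etaBracketR rₛ νo φo φo' Po Po' Po'' r| ≤ Q * Po r)
    -- the external-mode boundary datum (11.118) with `w′(a)/w(a) = (νo·Po(a) + (a − rₛ)·Po′(a))/((a − rₛ)·Po(a))`
    (Λ : ℝ)
    (hW : 0 < P.newcombF m k a * ((νo * Po a + (a - rₛ) * Po' a) / ((a - rₛ) * Po a))
              + (P.kDotB m k a * P.kDotBDagger m k a / k0Sq m k a + a ^ 2 * P.kDotB m k a ^ 2 * Λ / m)) :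
    ∀ ξ : ℝ → ℝ, ContDiffOn ℝ 1 ξ (Ioo (-b) b \ {rₛ}) → P.FiniteEnergyOn m k 0 a ξ →
      ξ a ≠ 0 → 0 < P.externalEnergy m k a Λ ξ := by
  set w₂ : ℝ → ℝ := eta rₛ ν P₂ with hw₂def
  set q₂ : ℝ → ℝ := fun r => (rₛ - r) ^ ν * etaBracket rₛ ν φ φ' P₂ P₂' P₂'' r
  set w : ℝ → ℝ := etaR rₛ νo Po with hwdef
  set q : ℝ → ℝ := fun r => (r - rₛ) ^ νo * etaBracketR rₛ νo φo φo' Po Po' Po'' r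
  have hw₂ : ContDiffOn ℝ 1 w₂ (Ioo 0 rₛ) := contDiffOn_eta (fun r hr => hr.2) hP₂C1
  have hw₂pos : ∀ r ∈ Ico r₀ rₛ, 0 < w₂ r := fun r hr => eta_pos hr.2 (hP₂pos r hr)
  have hq₂c : ContinuousOn q₂ (Ico r₀ rₛ) := continuousOn_rpow_mul (fun r hr => hr.2) hB₂c
  have hq₂w : ∀ r ∈ Ico r₀ rₛ, |q₂ r| ≤ Q₂ * w₂ r := fun r hr => abs_flux_le_of_bracket hr.2 (hB₂abs r hr)
  have hODE₂ : ∀ r ∈ Ioo r₀ rₛ, HasDerivAt (fun x => P.newcombF m k x * deriv w₂ x) (q₂ r) r := by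
    intro r hr
    have hrU : r ∈ Ioo r₂' rₛ := ⟨hr₂'.trans hr.1, hr.2⟩
    exact hasDerivAt_f_mul_deriv_eta isOpen_Ioo hrU (fun y hy => hy.2) hfact₂ hP₂ (hφ r hrU) (hP₂' r hrU)
  have hsuper₂ : ∀ r ∈ Ioo r₀ rₛ, q₂ r ≤ P.newcombG m k r * w₂ r :=
    fun r hr => super_of_bracket_le hr.2 (hB₂super r hr)
  have hmatch' : deriv w₂ r₀ / w₂ r₀ ≤ deriv w₁ r₀ / w₁ r₀ := by
    have hP20 : P₂ r₀ ≠ 0 := (hP₂pos r₀ ⟨le_rfl, hr₀ₛ⟩).ne'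
    rw [hw₂def, deriv_eta_div_eta hr₀ₛ (hP₂ r₀ ⟨hr₂', hr₀ₛ⟩) hP20]
    exact hmatch
  have hw : ContDiffOn ℝ 1 w (Ioo rₛ b) := contDiffOn_etaR (fun r hr => hr.1) hPoC1
  have hwpos : ∀ r ∈ Ioc rₛ a, 0 < w r := fun r hr => etaR_pos hr.1 (hPopos r hr)
  have hqc : ContinuousOn q (Ioc rₛ a) := continuousOn_rpow_mulR (fun r hr => hr.1) hBoc
  have hqw : ∀ r ∈ Ioc rₛ a, |q r| ≤ Q * w r := fun r hr => abs_fluxR_le_of_bracket hr.1 (hBoabs r hr)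
  have hODEw : ∀ r ∈ Ioo rₛ a, HasDerivAt (fun x => P.newcombF m k x * deriv w x) (q r) r := by
    intro r hr
    have hrU : r ∈ Ioo rₛ a' := ⟨hr.1, hr.2.trans ha'⟩
    exact hasDerivAt_f_mul_deriv_etaR isOpen_Ioo hrU (fun y hy => hy.1) hfacto hPo (hφo r hrU) (hPo' r hrU)
  have hsuper : ∀ r ∈ Ioo rₛ a, q r ≤ P.newcombG m k r * w r :=
    fun r hr => superR_of_bracket_le hr.1 (hBosuper r hr)
  have hW' : 0 < P.newcombF m k a * deriv w a / w a
      + (P.kDotB m k a * P.kDotBDagger m k a / k0Sq m k a + a ^ 2 * P.kDotB m k a ^ 2 * Λ / m) := by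
    have hPa0 : Po a ≠ 0 := (hPopos a ⟨hrₛa, le_rfl⟩).ne'
    rw [mul_div_assoc, hwdef, deriv_etaR_div_etaR hrₛa (hPo a ⟨hrₛa, ha'⟩) hPa0]
    exact hW
  exact externalPos_oneResonance_of_supersolutions hr₀ hr₀ₛ hrₛa hab hm hBθ hBz hp hBθ0 hFs hFin hFout hw₁ hw₁pos hq₁c
    hq₁w hODE₁ hsuper₁ hw₂ hw₂pos hq₂c hq₂w hODE₂ hsuper₂ hmatch' hw hwpos hqc hqw hODEw hsuper Λ hW'

end Profile

end ScrewPinch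

end Literature.MathematicalPhysics.MHD

end
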